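import Summits.CriticalPhenomena.CardyFormulaZ2.Theorems.CardyComplexConeSLESixFamiliesGiveCardyDefs
import Literature.Probability.RandomPlanarGeometry.ConformalRectangleProofs
import Literature.Probability.RandomPlanarGeometry.CritPercCardyFunctionProofs
import Literature.Probability.RandomPlanarGeometry.CollarDomain
import Literature.Topology.PlaneTopology.Crosscut
import HarnessLib

/-!
# Line `collar-touch-sandwich` (crux `SLESixFamiliesGiveCardy`, stmt-CriticalPhenomena-9654) — relabelling a conformal rectangle by two

Composition bookkeeping of the closing file `CardyComplexConeSLESixFamiliesGiveCardy.lean`: the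
lower comparison rectangle of the touch sandwich is labelled `(c, d, a, b)`, so the composition
needs the conformal rectangle `rotateTwo R` (same carrier, marks relabelled cyclically by two and
re-based so that they increase in `[0,1)`) and the fact that its Cardy cross-ratio is that of `R`
(`crossRatio_rotateTwo`: the cross-ratio formula is invariant under the relabelling
`(0 1 2 3) ↦ (2 3 0 1)` and under real Möbius maps; a uniformizing datum of `rotateTwo R` is obtained
from one of `R` through the Möbius self-map `z ↦ m - 1/z` of `ℍₒ`, `negInvUpperHalfPlane`).
Written by the line lead (from the checked skeleton `Lines/collar-touch-sandwich.lean`).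
-/

noncomputable section

open Set Filter Topology Metric MeasureTheory
open scoped NNReal
open UpperHalfPlane (upperHalfPlaneSet)
open Literature.Probability Literature.Probability.RandomPlanarGeometry
  Literature.Probability.LatticeModels Literature.Probability.Percolation

namespace Summit.CriticalPhenomena.CardyFormulaZ2.Cruxes.SLESixFamiliesGiveCardy.CollarTouchSandwich

/-! ### Relabelling a conformal rectangle by two (composition bookkeeping, proved here) -/

/-- The conformal rectangle `R = (Ω; a, b, c, d)` relabelled `(Ω; c, d, a, b)` and re-based so that the
marks increase in `[0,1)`: boundary loop `s ↦ R.boundary (s + R.mark 2)`, marks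
`(0, m₃ - m₂, m₀ + 1 - m₂, m₁ + 1 - m₂)`; same carrier, `pt i = R.pt (i + 2)`. -/
def rotateTwo (R : ConformalRectangle) : ConformalRectangle where
  carrier := R.carrier
  boundary s := R.boundary (s + R.mark 2)
  isOpen := R.isOpen
  isBounded := R.isBounded
  isConnected := R.isConnected
  continuous_boundary := R.continuous_boundary.comp (continuous_id.add continuous_const)
  periodic_boundary s := by
    show R.boundary (s + 1 + R.mark 2) = R.boundary (s + R.mark 2)
    rw [add_right_comm]; exact R.periodic_boundary _
  injOn_boundary := by
    intro s hs t ht h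
    have h' := R.toJordanDomain.injOn_boundary_Ico (R.mark 2)
      ⟨by linarith [hs.1], by linarith [hs.2]⟩ ⟨by linarith [ht.1], by linarith [ht.2]⟩ h
    linarith
  range_boundary := by
    rw [← R.range_boundary]
    ext z
    constructor
    · rintro ⟨s, rfl⟩; exact ⟨s + R.mark 2, rfl⟩
    · rintro ⟨s, rfl⟩; exact ⟨s - R.mark 2, by simp⟩
  mark := ![0, R.mark 3 - R.mark 2, R.mark 0 + 1 - R.mark 2, R.mark 1 + 1 - R.mark 2]
  strictMono_mark := by
    have hm := MarkedDomain.marks_chain R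
    refine Fin.strictMono_iff_lt_succ.2 fun i ↦ ?_
    fin_cases i <;> simp <;> linarith
  mark_mem i := by
    have hm := MarkedDomain.marks_chain R
    fin_cases i <;> simp <;> (try constructor) <;> linarith

/-- The carrier is unchanged by the relabelling. -/
@[simp] theorem carrier_rotateTwo (R : ConformalRectangle) : (rotateTwo R).carrier = R.carrier := rfl

/-- The boundary loop of the relabelled rectangle. -/
@[simp] theorem boundary_rotateTwo (R : ConformalRectangle) (s : ℝ) :
    (rotateTwo R).boundary s = R.boundary (s + R.mark 2) := rfl

/-- The marks of the relabelled rectangle. -/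
theorem mark_rotateTwo (R : ConformalRectangle) :
    (rotateTwo R).mark 0 = 0 ∧ (rotateTwo R).mark 1 = R.mark 3 - R.mark 2 ∧
      (rotateTwo R).mark 2 = R.mark 0 + 1 - R.mark 2 ∧ (rotateTwo R).mark 3 = R.mark 1 + 1 - R.mark 2 :=
  ⟨rfl, rfl, rfl, rfl⟩

/-- The marked points are relabelled by two: `pt i = R.pt (i + 2)`. -/
theorem pt_rotateTwo (R : ConformalRectangle) (i : Fin 4) : (rotateTwo R).pt i = R.pt (i + 2) := by
  fin_cases i
  · show R.boundary (0 + R.mark 2) = R.pt 2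
    rw [zero_add]; rfl
  · show R.boundary (R.mark 3 - R.mark 2 + R.mark 2) = R.pt 3
    rw [sub_add_cancel]; rfl
  · show R.boundary (R.mark 0 + 1 - R.mark 2 + R.mark 2) = R.pt 0
    rw [sub_add_cancel, R.periodic_boundary]; rfl
  · show R.boundary (R.mark 1 + 1 - R.mark 2 + R.mark 2) = R.pt 1
    rw [sub_add_cancel, R.periodic_boundary]; rfl

/-- The inversion `z ↦ -z⁻¹`, a conformal automorphism of `ℍₒ` (its own inverse). -/
def negInvUpperHalfPlane : ConformalEquiv upperHalfPlaneSet upperHalfPlaneSet where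
  toFun z := -z⁻¹
  invFun z := -z⁻¹
  source := upperHalfPlaneSet
  target := upperHalfPlaneSet
  map_source' z hz := by
    change 0 < z.im at hz
    change 0 < (-z⁻¹).im
    have hz0 : z ≠ 0 := by rintro rfl; simp at hz
    rw [Complex.neg_im, Complex.inv_im, neg_div, neg_neg]
    exact div_pos hz (Complex.normSq_pos.2 hz0)
  map_target' z hz := by
    change 0 < z.im at hz
    change 0 < (-z⁻¹).im
    have hz0 : z ≠ 0 := by rintro rfl; simp at hz
    rw [Complex.neg_im, Complex.inv_im, neg_div, neg_neg]
    exact div_pos hz (Complex.normSq_pos.2 hz0)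
  left_inv' z _ := by simp
  right_inv' z _ := by simp
  source_eq := rfl
  target_eq := rfl
  differentiableOn := by
    refine (differentiableOn_inv.mono ?_).neg
    intro z hz
    change 0 < z.im at hz
    rintro rfl; simp at hz
  differentiableOn_symm := by
    refine (differentiableOn_inv.mono ?_).neg
    intro z hz
    change 0 < z.im at hz
    rintro rfl; simp at hz

/-- `negInvUpperHalfPlane` acts as `z ↦ -z⁻¹`. -/
@[simp] theorem negInvUpperHalfPlane_apply (z : ℂ) : negInvUpperHalfPlane z = -z⁻¹ := rfl

/-- The real Möbius map `t ↦ -1/(t - m)` of the relabelling. -/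
def rotMap (m t : ℝ) : ℝ := -(t - m)⁻¹

/-- Differences of `rotMap`. -/
theorem rotMap_sub_rotMap {m a b : ℝ} (ha : a ≠ m) (hb : b ≠ m) :
    rotMap m a - rotMap m b = (a - b) / ((a - m) * (b - m)) := by
  have ha' : a - m ≠ 0 := sub_ne_zero.2 ha
  have hb' : b - m ≠ 0 := sub_ne_zero.2 hb
  simp only [rotMap]
  field_simp
  ring

/-- Möbius invariance of Cardy's cross-ratio under `rotMap`. -/
theorem crossRatio_rotMap {m : ℝ} {z : Fin 4 → ℝ} (hz : ∀ i, z i ≠ m) (h02 : z 0 ≠ z 2)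
    (h13 : z 1 ≠ z 3) : crossRatio (fun i ↦ rotMap m (z i)) = crossRatio z := by
  simp only [crossRatio]
  rw [rotMap_sub_rotMap (hz 0) (hz 1), rotMap_sub_rotMap (hz 2) (hz 3),
    rotMap_sub_rotMap (hz 0) (hz 2), rotMap_sub_rotMap (hz 1) (hz 3)]
  have h0 := sub_ne_zero.2 (hz 0)
  have h1 := sub_ne_zero.2 (hz 1)
  have h2 := sub_ne_zero.2 (hz 2)
  have h3 := sub_ne_zero.2 (hz 3)
  have h02' := sub_ne_zero.2 h02
  have h13' := sub_ne_zero.2 h13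
  field_simp

/-- The cross-ratio formula is invariant under the relabelling `(0 1 2 3) ↦ (2 3 0 1)`. -/
theorem crossRatio_perm_two (x : Fin 4 → ℝ) : crossRatio (fun i : Fin 4 ↦ x (i + 2)) = crossRatio x := by
  simp only [crossRatio, show (0 : Fin 4) + 2 = 2 from rfl, show (1 : Fin 4) + 2 = 3 from rfl,
    show (2 : Fin 4) + 2 = 0 from rfl, show (3 : Fin 4) + 2 = 1 from rfl]
  ring

/-- **Cross-ratio of the relabelled rectangle**: every uniformizing datum of `rotateTwo R` has the same
Cardy cross-ratio as every uniformizing datum of `R` (the cross-ratio formula is invariant under the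
relabelling `(0 1 2 3) ↦ (2 3 0 1)` and under real Möbius maps; a datum of `rotateTwo R` is obtained
from one of `R` by the Möbius self-map `z ↦ m - 1/z` of `ℍₒ`, `m` strictly between `x 1` and `x 2`). -/
theorem crossRatio_rotateTwo {R : ConformalRectangle} {φ : ConformalEquiv upperHalfPlaneSet R.carrier}
    {x : Fin 4 → ℝ} (hux : R.IsUniformizing φ x)
    {φ' : ConformalEquiv upperHalfPlaneSet (rotateTwo R).carrier} {x' : Fin 4 → ℝ}
    (hux' : (rotateTwo R).IsUniformizing φ' x') : crossRatio x' = crossRatio x := by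
  -- a pole strictly between `x 1` and `x 2`
  set m : ℝ := (x 1 + x 2) / 2 with hm
  have hinj := hux.injective
  have hxm : ∀ i, x i ≠ m := by
    intro i h
    rcases hux.1 with hmono | hanti
    · have h01 := hmono (show (0 : Fin 4) < 1 by decide)
      have h12 := hmono (show (1 : Fin 4) < 2 by decide)
      have h23 := hmono (show (2 : Fin 4) < 3 by decide)
      fin_cases i <;> simp at h <;> linarith
    · have h01 := hanti (show (0 : Fin 4) < 1 by decide)
      have h12 := hanti (show (1 : Fin 4) < 2 by decide)
      have h23 := hanti (show (2 : Fin 4) < 3 by decide)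
      fin_cases i <;> simp at h <;> linarith
  -- the Möbius self-map `N z = m - 1/z` of `ℍₒ` and the transported datum
  set N : ConformalEquiv upperHalfPlaneSet upperHalfPlaneSet :=
    negInvUpperHalfPlane.trans (addRealUpperHalfPlane m) with hN
  set ψ : ConformalEquiv upperHalfPlaneSet (rotateTwo R).carrier := N.trans φ with hψ
  set y : Fin 4 → ℝ := fun i ↦ rotMap m (x (i + 2)) with hy
  -- the matrix of `N`
  set g : Matrix.SpecialLinearGroup (Fin 2) ℝ :=
    ⟨!![m, -1; 1, 0], by simp [Matrix.det_fin_two]⟩ with hg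
  have hg00 : g 0 0 = m := rfl
  have hg01 : g 0 1 = -1 := rfl
  have hg10 : g 1 0 = 1 := rfl
  have hg11 : g 1 1 = 0 := rfl
  have hNz : ∀ z ∈ upperHalfPlaneSet, ψ z = φ (moebiusFun g z) := by
    intro z hz
    have hz0 : z ≠ 0 := by rintro rfl; simp [upperHalfPlaneSet] at hz
    show φ (-z⁻¹ + (m : ℂ)) = φ (moebiusFun g z)
    congr 1
    have h1 : ((g 1 0 : ℝ) : ℂ) * z + ((g 1 1 : ℝ) : ℂ) = z := by
      rw [hg10, hg11]; push_cast; ring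
    have h2 : ((g 0 0 : ℝ) : ℂ) * z + ((g 0 1 : ℝ) : ℂ) = (m : ℂ) * z - 1 := by
      rw [hg00, hg01]; push_cast; ring
    rw [moebiusFun, h1, h2, eq_div_iff hz0, add_mul, neg_mul, inv_mul_cancel₀ hz0]
    ring
  have hyne : ∀ i, y i ≠ 0 := by
    intro i
    simp only [hy, rotMap, ne_eq, neg_eq_zero, inv_eq_zero, sub_eq_zero]
    exact hxm _
  have hbv : ∀ i, ψ.HasBoundaryValue (y i) ((rotateTwo R).pt i) := by
    intro i
    rw [pt_rotateTwo]
    refine hasBoundaryValue_of_moebius hNz (x := y i) ?_ ?_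
    · rw [hg10, hg11, one_mul, add_zero]; exact hyne i
    · have hval : (g 0 0 * y i + g 0 1) / (g 1 0 * y i + g 1 1) = x (i + 2) := by
        rw [hg00, hg01, hg10, hg11, one_mul, add_zero]
        have := hyne i
        simp only [hy, rotMap] at this ⊢
        have hxm' : x (i + 2) - m ≠ 0 := sub_ne_zero.2 (hxm _)
        field_simp
        ring
      rw [hval]
      exact hux.2 (i + 2)
  -- monotonicity of `y`
  have hymono : StrictMono y ∨ StrictAnti y := by
    have key : ∀ {s t : ℝ}, s < t → (t < m ∨ m < s) → rotMap m s < rotMap m t := by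
      intro s t hst hside
      simp only [rotMap]
      rcases hside with ht | hs
      · have h1 : s - m < 0 := by linarith
        have h2 : t - m < 0 := by linarith
        rw [neg_lt_neg_iff, inv_lt_inv_of_neg h2 h1]; linarith
      · have h1 : 0 < s - m := by linarith
        have h2 : 0 < t - m := by linarith
        rw [neg_lt_neg_iff, inv_lt_inv₀ h2 h1]; linarith
    have cross : ∀ {s t : ℝ}, s < m → m < t → rotMap m t < rotMap m s := by
      intro s t hs ht
      simp only [rotMap]
      have h1 : s - m < 0 := by linarith
      have h2 : 0 < t - m := by linarith
      have : (t - m)⁻¹ > 0 := inv_pos.2 h2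
      have : (s - m)⁻¹ < 0 := inv_lt_zero.2 h1
      linarith
    rcases hux.1 with hmono | hanti
    · left
      have h01 := hmono (show (0 : Fin 4) < 1 by decide)
      have h12 := hmono (show (1 : Fin 4) < 2 by decide)
      have h23 := hmono (show (2 : Fin 4) < 3 by decide)
      have hm1 : x 1 < m := by rw [hm]; linarith
      have hm2 : m < x 2 := by rw [hm]; linarith
      refine Fin.strictMono_iff_lt_succ.2 fun i ↦ ?_
      fin_cases i
      · show y 0 < y 1
        simp only [hy]
        exact key h23 (Or.inr hm2)
      · show y 1 < y 2
        simp only [hy]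
        show rotMap m (x 3) < rotMap m (x 0)
        exact cross (by linarith) (by linarith)
      · show y 2 < y 3
        simp only [hy]
        show rotMap m (x 0) < rotMap m (x 1)
        exact key h01 (Or.inl hm1)
    · right
      have h01 := hanti (show (0 : Fin 4) < 1 by decide)
      have h12 := hanti (show (1 : Fin 4) < 2 by decide)
      have h23 := hanti (show (2 : Fin 4) < 3 by decide)
      have hm1 : m < x 1 := by rw [hm]; linarith
      have hm2 : x 2 < m := by rw [hm]; linarith
      refine Fin.strictAnti_iff_succ_lt.2 fun i ↦ ?_
      fin_cases i
      · show y 1 < y 0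
        simp only [hy]
        exact key h23 (Or.inl hm2)
      · show y 2 < y 1
        simp only [hy]
        show rotMap m (x 0) < rotMap m (x 3)
        exact cross (by linarith) (by linarith)
      · show y 3 < y 2
        simp only [hy]
        show rotMap m (x 1) < rotMap m (x 0)
        exact key h01 (Or.inr hm1)
  have huy : (rotateTwo R).IsUniformizing ψ y := ⟨hymono, hbv⟩
  -- all data of `rotateTwo R` share the cross-ratio of `y`, which is that of `x`
  rw [ConformalRectangle.crossRatio_eq_of_isUniformizing_holds hux' huy]
  have hz : ∀ i : Fin 4, (fun i : Fin 4 ↦ x (i + 2)) i ≠ m := fun i ↦ hxm _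
  have h02 : (fun i : Fin 4 ↦ x (i + 2)) 0 ≠ (fun i : Fin 4 ↦ x (i + 2)) 2 := hinj.ne (by decide)
  have h13 : (fun i : Fin 4 ↦ x (i + 2)) 1 ≠ (fun i : Fin 4 ↦ x (i + 2)) 3 := hinj.ne (by decide)
  calc crossRatio y = crossRatio (fun i : Fin 4 ↦ rotMap m ((fun i : Fin 4 ↦ x (i + 2)) i)) := rfl
    _ = crossRatio (fun i : Fin 4 ↦ x (i + 2)) := crossRatio_rotMap hz h02 h13
    _ = crossRatio x := crossRatio_perm_two x

/-- Registered sub-goal (composition bookkeeping): arrow form of `crossRatio_rotateTwo`. -/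
theorem crossRatio_rotateTwo_eq : ∀ (R : ConformalRectangle) (φ : ConformalEquiv upperHalfPlaneSet R.carrier) (x : Fin 4 → ℝ), R.IsUniformizing φ x → ∀ (φ' : ConformalEquiv upperHalfPlaneSet (rotateTwo R).carrier) (x' : Fin 4 → ℝ), (rotateTwo R).IsUniformizing φ' x' → crossRatio x' = crossRatio x :=
  fun _ _ _ hux _ _ hux' ↦ crossRatio_rotateTwo hux hux'

end Summit.CriticalPhenomena.CardyFormulaZ2.Cruxes.SLESixFamiliesGiveCardy.CollarTouchSandwich

end
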